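import Literature.Algebra.Polynomial.DiscriminantRootProduct
import Mathlib.FieldTheory.IsAlgClosed.AlgebraicClosure
import HarnessLib

/-!
# The discriminant of a pure equation: `D(Xⁿ − a) = (−1)^{n(n−1)/2 + (n−1)} nⁿ a^{n−1}` — a worked instance of Bombieri–Gubler, *Heights in Diophantine Geometry*, Appendix B.1, Remark B.1.5 / B.1.9

Topic `Literature/Algebra/Polynomial`, namespace `Literature.Algebra.Polynomial.DiscriminantXPowSubC`
(lane `lit-semireg`, literature-prover hsemireg-lit-8 g30).  Everything here is **proved**; theorems only
(no `def`, no named fact, no instance, no notation).  Sequel of `DiscriminantRootProduct`: with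
`D_f = (−1)^{n(n−1)/2} ∏_ξ f′(ξ)` (B.1.5/B.1.9) and `f = Xⁿ − a`, `f′(ξ) = n ξ^{n−1}`,
`∏ ξ = (−1)^{n−1} a` (Vieta), one gets the classical value of the discriminant of the pure equation
`Xⁿ = a`, which Mathlib's `Polynomial.discr` API (degrees `≤ 3` only) does not provide.

Source, verbatim (held `book:bombieri2006-heights-diophantine-geometry`, chunks p0579–p0580), Appendix
B.1: «**Remark B.1.5.** … `D_f = ∏_{i>j} (ξ_i − ξ_j)² = (−1)^{n(n−1)/2} ∏_{i≠j} (ξ_i − ξ_j)`.»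
«**B.1.9.** … `D_f = (−1)^{n(n−1)/2} res_{n,n−1}(f, f′)`.»  (The printed text does not single out
`Xⁿ − a`; the value below is the routine evaluation of B.1.5/B.1.9 for it, stated as such.)

## What is typed (all `theorem`s)

* `discr_X_pow_sub_C_of_splits` (over a domain in which `Xⁿ − a` splits),
  **`discr_X_pow_sub_C`** (over any field, `n ≥ 1`):
  `D(Xⁿ − a) = (−1)^{n(n−1)/2 + (n−1)} · nⁿ · a^{n−1}`;
* the cases `discr_X_sq_sub_C` (`4a`), `discr_X_pow_three_sub_C` (`−27a²`),
  `discr_X_pow_five_sub_C` (`3125a⁴`), `discr_X_pow_five_sub_C_pos` (`> 0` for `a ≠ 0` over an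
  ordered field — the sign needed for Brzeziński's Exercise 13.11 (b): `X⁵ − 2` is solvable by
  radicals although `Δ > 0`).

Honest scope / deviations.  In characteristic `p ∣ n` both sides vanish (`nⁿ = 0`, `f′ = 0`), so the
formula holds verbatim.  DEDUP: `rg "X \^ n - C .*discr|discr.*X_pow_sub_C" Literature` → nothing;
Mathlib: `discr_of_degree_eq_two/three` only.

## References
* [BombieriGubler2006] E. Bombieri, W. Gubler, *Heights in Diophantine Geometry*, CUP 2006,
  Appendix B.1, Remark B.1.5, B.1.9, B.1.12.
-/

open Polynomial Finset
open scoped Polynomial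

namespace Literature.Algebra.Polynomial.DiscriminantXPowSubC

section Domain

variable {R : Type*} [CommRing R] [IsDomain R]

/-- **`D(Xⁿ − a)` over a domain where it splits.** For `n ≥ 1` and `Xⁿ − a` split in `R`:
`D(Xⁿ − a) = (−1)^{n(n−1)/2 + (n−1)} · nⁿ · a^{n−1}`.
[cite: BombieriGubler2006, Appendix B, Remark B.1.5 / B.1.9 (D_f = (−1)^{n(n−1)/2} ∏ f′(ξ_i))] -/
theorem discr_X_pow_sub_C_of_splits {n : ℕ} (hn : 0 < n) (a : R)
    (hs : (X ^ n - C a : R[X]).Splits) :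
    (X ^ n - C a : R[X]).discr =
      (-1) ^ (n * (n - 1) / 2 + (n - 1)) * (n : R) ^ n * a ^ (n - 1) := by
  classical
  have hm : (X ^ n - C a : R[X]).Monic := monic_X_pow_sub_C a hn.ne'
  have hnat : (X ^ n - C a : R[X]).natDegree = n := natDegree_X_pow_sub_C
  have hcard : Multiset.card (X ^ n - C a : R[X]).roots = n := by
    rw [splits_iff_card_roots.mp hs, hnat]
  have hprod : (X ^ n - C a : R[X]).roots.prod = (-1) ^ (n - 1) * a := by
    have h := hs.coeff_zero_eq_prod_roots_of_monic hm
    rw [hnat, coeff_sub, coeff_X_pow, if_neg hn.ne, coeff_C_zero, zero_sub] at h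
    -- `-a = (-1)^n * prod`
    have h2 : (X ^ n - C a : R[X]).roots.prod = (-1) ^ n * (-a) := by
      rw [h, ← mul_assoc, ← pow_add, ← two_mul, pow_mul, neg_one_sq, one_pow, one_mul]
    rw [h2]
    obtain ⟨k, rfl⟩ : ∃ k, n = k + 1 := ⟨n - 1, by omega⟩
    rw [Nat.add_sub_cancel, pow_succ]
    ring
  rw [DiscriminantRootProduct.discr_eq_prod_roots_eval_derivative hm hs, hnat]
  have hder : ∀ x : R, (X ^ n - C a : R[X]).derivative.eval x = (n : R) * x ^ (n - 1) := by
    intro x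
    simp [derivative_X_pow]
  simp_rw [hder]
  rw [Multiset.prod_map_mul, Multiset.map_const', Multiset.prod_replicate, hcard,
    Multiset.prod_map_pow, Multiset.map_id', hprod, mul_pow, ← pow_mul]
  -- `(−1)^{(n−1)²} = (−1)^{n−1}`
  have hsq : ((-1 : R) ^ ((n - 1) * (n - 1))) = (-1) ^ (n - 1) := by
    obtain ⟨k, hk⟩ := Nat.even_mul_pred_self (n - 1)
    have e : (n - 1) * (n - 1) = (n - 1) + (n - 1) * (n - 1 - 1) := by
      rcases Nat.eq_zero_or_pos (n - 1) with h0 | hpos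
      · rw [h0]
      · obtain ⟨j, hj⟩ : ∃ j, n - 1 = j + 1 := ⟨n - 1 - 1, by omega⟩
        rw [hj, Nat.add_sub_cancel]; ring
    rw [e, pow_add, hk, ← two_mul, pow_mul, neg_one_sq, one_pow, mul_one]
  rw [hsq, pow_add]
  ring

end Domain

section Field

variable {K : Type*} [Field K]

/-- **`D(Xⁿ − a) = (−1)^{n(n−1)/2 + (n−1)} nⁿ a^{n−1}`** over any field, `n ≥ 1`
(the classical value of the discriminant of a pure equation; from B.1.5/B.1.9 in an algebraic
closure). [cite: BombieriGubler2006, Appendix B, Remark B.1.5, B.1.9, B.1.12] -/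
theorem discr_X_pow_sub_C {n : ℕ} (hn : 0 < n) (a : K) :
    (X ^ n - C a : K[X]).discr =
      (-1) ^ (n * (n - 1) / 2 + (n - 1)) * (n : K) ^ n * a ^ (n - 1) := by
  have hinj := (algebraMap K (AlgebraicClosure K)).injective
  apply hinj
  have hmap : (X ^ n - C a : K[X]).map (algebraMap K (AlgebraicClosure K)) =
      X ^ n - C (algebraMap K (AlgebraicClosure K) a) := by
    rw [Polynomial.map_sub, Polynomial.map_pow, map_X, map_C]
  rw [← DiscriminantRootProduct.discr_map_of_injective _ hinj, hmap,
    discr_X_pow_sub_C_of_splits hn _ (IsAlgClosed.splits _), map_mul, map_mul, map_pow, map_pow,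
    map_pow, map_neg, map_one, map_natCast]

/-- `D(X² − a) = 4a`. [cite: BombieriGubler2006, Appendix B, Remark B.1.5] -/
theorem discr_X_sq_sub_C (a : K) : (X ^ 2 - C a : K[X]).discr = 4 * a := by
  rw [discr_X_pow_sub_C two_pos]; norm_num

/-- `D(X³ − a) = −27a²`. [cite: BombieriGubler2006, Appendix B, Remark B.1.5] -/
theorem discr_X_pow_three_sub_C (a : K) : (X ^ 3 - C a : K[X]).discr = -27 * a ^ 2 := by
  rw [discr_X_pow_sub_C three_pos]; norm_num

/-- `D(X⁵ − a) = 3125a⁴ = 5⁵a⁴`. [cite: BombieriGubler2006, Appendix B, Remark B.1.5] -/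
theorem discr_X_pow_five_sub_C (a : K) : (X ^ 5 - C a : K[X]).discr = 3125 * a ^ 4 := by
  rw [discr_X_pow_sub_C (by norm_num : 0 < 5)]; norm_num

/-- In particular over an ordered field `D(X⁵ − a) > 0` for `a ≠ 0`.
[cite: BombieriGubler2006, Appendix B, Remark B.1.5] -/
theorem discr_X_pow_five_sub_C_pos {K : Type*} [Field K] [LinearOrder K] [IsStrictOrderedRing K]
    {a : K} (ha : a ≠ 0) : 0 < (X ^ 5 - C a : K[X]).discr := by
  rw [discr_X_pow_five_sub_C]
  have h4 : 0 < a ^ 4 := by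
    rw [show (4 : ℕ) = 2 * 2 from rfl, pow_mul]
    exact pow_pos (sq_pos_iff.mpr ha) 2
  positivity

end Field

end Literature.Algebra.Polynomial.DiscriminantXPowSubC
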